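import Mathlib
import Summits.ValiantsHypothesis.ValiantsHypothesis.Theorems.NewtonUnitEquationsTwoProductsRadix

/-!
# Two-base radix residues (crux `TwoProducts`, line corner-log-linearization; helper file of the
# stub `stub_engineTwoBaseRadix`)

The residue step of the rigid radix argument of `…TwoProductsRadix.lean` (uniform dilation
`MvPolynomial.expand M : (x, y) ↦ (x^M, y^M)`, exponents `M • e`) for the TWO-BASE dilation
`(x, y) ↦ (x^{s₀}, y^{s₁})` with a scale vector `s : Fin 2 → ℕ`, all `s j ≥ 1`: the lattice is
`s₀ℕ × s₁ℕ`, residues are taken mod `s₀` in the first coordinate and mod `s₁` in the second.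
No new definitions: exponent vectors are scaled by the pointwise action `s • e = (s₀ e₀, s₁ e₁)` of
`Fin 2 → ℕ` on `Fin 2 →₀ ℕ` (`Finsupp.pointwiseScalarSemiring`), the quotient is
`Finsupp.equivFunOnFinite.symm (⇑e / s)`, the dilation is the algebra endomorphism
`MvPolynomial.bind₁ (j ↦ X_j ^ s_j)` (on monomials: `monomial e c ↦ monomial (s • e) c`,
`dil_monomial`), and the lattice part of `F` contracted by `s` is the polynomial `F₀` with
`coeff d F₀ = coeff (s • d) F` (`coeff_latticePart`).

* `residueOff`: for `G(0) ≠ 0` and a strictly positive weight `w`, a support point `e ∉ s • ℕ²` of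
  `F · G(x^{s₀}, y^{s₁})` that is strictly `w`-lighter than every other nonzero support point is a
  monomial of `F` (the residue classes mod `s` of the support do not interact; the `w`-lightest
  monomial `d₀` of `F` in the class of `e` survives in the Cauchy product: `coeff_{d₀} = F_{d₀} G₀`).
* `coeff_smul_mul_dil` (Mahler's identity): `coeff_{s • q}(F · G(x^{s₀}, y^{s₁})) = coeff_q(F₀ · G)`.
* `stub_twoBaseRadixResidueStep` (registered sub-goal): a south-west vertex of `supp(F · G(x^{s₀}, y^{s₁})) ∖ 0` (`G(0) = 1`) is a monomial of `F`
  or `s •` a south-west vertex of `supp(F₀ · G) ∖ 0`; on the lattice the weight `w` becomes the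
  twisted weight `(w₀ s₀, w₁ s₁)`, still strictly positive (`wt_smul`).

Positivity of weights (`DepthOne.wt_pos`, `DepthOne.wt_nonneg`) is reused from `…TwoProductsDepthOne`.
-/

set_option linter.dupNamespace false

namespace Summit.ValiantsHypothesis.ValiantsHypothesis.Theorems.TwoProducts.TwoBaseRadixResidue

open scoped BigOperators Pointwise
open MvPolynomial

/-! ## Pointwise scaling `s • e` of exponent vectors -/

/-- `(s • e) j = s j * e j` for the pointwise action of `Fin 2 → ℕ` on `Fin 2 →₀ ℕ`. -/
theorem pointwise_smul_apply (s : Fin 2 → ℕ) (e : Fin 2 →₀ ℕ) (j : Fin 2) :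
    (s • e) j = s j * e j := rfl

/-- The support (set of nonzero coordinates) of `s • e` is inside that of `e`. -/
theorem support_smul_subset (s : Fin 2 → ℕ) (e : Fin 2 →₀ ℕ) : (s • e).support ⊆ e.support := by
  intro j hj
  rw [Finsupp.mem_support_iff] at hj ⊢
  exact fun h => hj (by rw [pointwise_smul_apply, h, mul_zero])

/-- The quotient of `s • e` by `s` is `e` (positive scale vector). -/
theorem ediv_smul {s : Fin 2 → ℕ} (hs : ∀ j, 1 ≤ s j) (e : Fin 2 →₀ ℕ) :
    Finsupp.equivFunOnFinite.symm (⇑(s • e) / s) = e := by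
  ext j
  simp [Nat.mul_div_cancel_left _ (hs j)]

/-- `s •` is injective for a positive scale vector. -/
theorem pointwise_smul_right_inj {s : Fin 2 → ℕ} (hs : ∀ j, 1 ≤ s j)
    (a b : Fin 2 →₀ ℕ) : s • a = s • b ↔ a = b :=
  ⟨fun h => by rw [← ediv_smul hs a, h, ediv_smul hs b], fun h => by rw [h]⟩

/-- A point of the lattice `s • ℕ²` is `s •` its quotient. -/
theorem smul_ediv_of_dvd {s : Fin 2 → ℕ} {e : Fin 2 →₀ ℕ} (h : s 0 ∣ e 0 ∧ s 1 ∣ e 1) :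
    s • Finsupp.equivFunOnFinite.symm (⇑e / s) = e := by
  ext j
  fin_cases j
  · simpa [pointwise_smul_apply] using Nat.mul_div_cancel' h.1
  · simpa [pointwise_smul_apply] using Nat.mul_div_cancel' h.2

/-- `s • e ≠ 0` for `e ≠ 0` and a positive scale vector. -/
theorem smul_ne_zero_of_ne_zero {s : Fin 2 → ℕ} (hs : ∀ j, 1 ≤ s j) {e : Fin 2 →₀ ℕ}
    (he : e ≠ 0) : s • e ≠ 0 :=
  fun h => he ((pointwise_smul_right_inj hs e 0).mp (h.trans (smul_zero s).symm))

/-- For a positive scale vector, `s •` preserves and reflects the coordinatewise order. -/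
theorem pointwise_smul_le_iff {s : Fin 2 → ℕ} (hs : ∀ j, 1 ≤ s j)
    (b q : Fin 2 →₀ ℕ) : s • b ≤ s • q ↔ b ≤ q := by
  simp only [Finsupp.le_def, pointwise_smul_apply]
  exact ⟨fun h i => Nat.le_of_mul_le_mul_left (h i) (hs i), fun h i => Nat.mul_le_mul_left _ (h i)⟩

/-- `s •` commutes with truncated subtraction. -/
theorem smul_tsub_smul (s : Fin 2 → ℕ) (b q : Fin 2 →₀ ℕ) : s • q - s • b = s • (q - b) := by
  ext i
  simp only [Finsupp.tsub_apply, pointwise_smul_apply, mul_tsub]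

/-- The residues mod `s` of the coordinates of `a + s • b` are those of `a`. -/
theorem mod_add_smul_apply (s : Fin 2 → ℕ) (a b : Fin 2 →₀ ℕ) (j : Fin 2) :
    (a + s • b) j % s j = a j % s j := by
  simp [Finsupp.add_apply, pointwise_smul_apply, Nat.add_mul_mod_self_left]

/-! ## Weights -/

/-- The `w`-weight of `s • e` is the twisted weight `(w₀ s₀, w₁ s₁)` of `e`. -/
theorem wt_smul (w : Fin 2 → ℤ) (s : Fin 2 → ℕ) (e : Fin 2 →₀ ℕ) :
    w 0 * ((s • e) 0 : ℤ) + w 1 * ((s • e) 1 : ℤ) =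
      w 0 * (s 0 : ℤ) * (e 0 : ℤ) + w 1 * (s 1 : ℤ) * (e 1 : ℤ) := by
  simp only [pointwise_smul_apply, Nat.cast_mul]
  ring

/-- The `w`-weight of `a + s • b` is the weight of `a` plus the twisted weight of `b`. -/
theorem wt_add_smul (w : Fin 2 → ℤ) (s : Fin 2 → ℕ) (a b : Fin 2 →₀ ℕ) :
    w 0 * ((a + s • b) 0 : ℤ) + w 1 * ((a + s • b) 1 : ℤ) =
      (w 0 * (a 0 : ℤ) + w 1 * (a 1 : ℤ)) +
        (w 0 * (s 0 : ℤ) * (b 0 : ℤ) + w 1 * (s 1 : ℤ) * (b 1 : ℤ)) := by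
  simp only [Finsupp.add_apply, pointwise_smul_apply, Nat.cast_add, Nat.cast_mul]
  ring

/-- The twisted weight of a strictly positive weight is strictly positive. -/
theorem twist_pos {w : Fin 2 → ℤ} {s : Fin 2 → ℕ} (hs : ∀ j, 1 ≤ s j) (j : Fin 2) (hw : 0 < w j) :
    0 < w j * (s j : ℤ) :=
  mul_pos hw (by exact_mod_cast hs j)

/-! ## The two-base dilation `bind₁ (j ↦ X_j ^ s_j)` -/

/-- The dilation on monomials: `c x^e ↦ c x^{s • e}`. -/
theorem dil_monomial (s : Fin 2 → ℕ) (e : Fin 2 →₀ ℕ) (c : ℂ) :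
    bind₁ (fun j => (X j : MvPolynomial (Fin 2) ℂ) ^ s j) (monomial e c) = monomial (s • e) c := by
  rw [bind₁_monomial, monomial_eq, Finsupp.prod_of_support_subset _ (support_smul_subset s e)]
  · simp [pow_mul, pointwise_smul_apply]
  · simp

/-- The dilation of `p` as a sum of monomials over the support of `p`. -/
theorem dil_eq_sum (s : Fin 2 → ℕ) (p : MvPolynomial (Fin 2) ℂ) :
    bind₁ (fun j => (X j : MvPolynomial (Fin 2) ℂ) ^ s j) p =
      ∑ b ∈ p.support, monomial (s • b) (coeff b p) := by
  conv_lhs => rw [p.as_sum]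
  rw [map_sum]
  exact Finset.sum_congr rfl fun b _ => dil_monomial s b (coeff b p)

/-- The coefficients of the dilation of `p`. -/
theorem coeff_dil (s : Fin 2 → ℕ) (p : MvPolynomial (Fin 2) ℂ) (e' : Fin 2 →₀ ℕ) :
    coeff e' (bind₁ (fun j => (X j : MvPolynomial (Fin 2) ℂ) ^ s j) p) =
      ∑ b ∈ p.support, if s • b = e' then coeff b p else 0 := by
  rw [dil_eq_sum, coeff_sum]
  simp only [coeff_monomial]

/-- A nonzero coefficient of the dilation of `p` sits at `s • b` for a support point `b` of `p`. -/
theorem exists_of_coeff_dil_ne_zero (s : Fin 2 → ℕ) (p : MvPolynomial (Fin 2) ℂ) {e' : Fin 2 →₀ ℕ}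
    (h : coeff e' (bind₁ (fun j => (X j : MvPolynomial (Fin 2) ℂ) ^ s j) p) ≠ 0) :
    ∃ b, coeff b p ≠ 0 ∧ e' = s • b := by
  rw [coeff_dil] at h
  obtain ⟨b, hb, hne⟩ := Finset.exists_ne_zero_of_sum_ne_zero h
  by_cases hbe : s • b = e'
  · exact ⟨b, mem_support_iff.mp hb, hbe.symm⟩
  · exact absurd (if_neg hbe) hne

/-- `coeff (s • e)` of the dilation of `p` is `coeff e p` (positive scale vector). -/
theorem coeff_dil_smul {s : Fin 2 → ℕ} (hs : ∀ j, 1 ≤ s j) (p : MvPolynomial (Fin 2) ℂ)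
    (e : Fin 2 →₀ ℕ) : coeff (s • e) (bind₁ (fun j => (X j : MvPolynomial (Fin 2) ℂ) ^ s j) p) =
      coeff e p := by
  rw [coeff_dil]
  simp only [pointwise_smul_right_inj hs, Finset.sum_ite_eq']
  split_ifs with h
  · rfl
  · exact (notMem_support_iff.mp h).symm

/-- The dilation keeps the constant term (positive scale vector). -/
theorem coeff_zero_dil {s : Fin 2 → ℕ} (hs : ∀ j, 1 ≤ s j) (p : MvPolynomial (Fin 2) ℂ) :
    coeff 0 (bind₁ (fun j => (X j : MvPolynomial (Fin 2) ℂ) ^ s j) p) = coeff 0 p := by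
  have h := coeff_dil_smul hs p 0
  rwa [smul_zero] at h

/-! ## The lattice part `F₀ = ∑_{d} F_{s • d} x^d` -/

/-- The defining coefficient identity of the lattice part: `coeff d F₀ = coeff (s • d) F`. -/
theorem coeff_latticePart {s : Fin 2 → ℕ} (hs : ∀ j, 1 ≤ s j) (F : MvPolynomial (Fin 2) ℂ)
    (d : Fin 2 →₀ ℕ) :
    coeff d (∑ d ∈ F.support.image (fun e : Fin 2 →₀ ℕ => Finsupp.equivFunOnFinite.symm (⇑e / s)),
      (monomial d (coeff (s • d) F) : MvPolynomial (Fin 2) ℂ)) = coeff (s • d) F := by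
  classical
  rw [coeff_sum]
  simp only [coeff_monomial]
  rw [Finset.sum_ite_eq']
  split_ifs with h
  · rfl
  · symm
    by_contra hne
    exact h (Finset.mem_image.2 ⟨s • d, mem_support_iff.2 hne, ediv_smul hs d⟩)

/-- Support of the lattice part. -/
theorem mem_support_latticePart {s : Fin 2 → ℕ} (hs : ∀ j, 1 ≤ s j) (F : MvPolynomial (Fin 2) ℂ)
    (d : Fin 2 →₀ ℕ) :
    d ∈ (∑ d ∈ F.support.image (fun e : Fin 2 →₀ ℕ => Finsupp.equivFunOnFinite.symm (⇑e / s)),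
      (monomial d (coeff (s • d) F) : MvPolynomial (Fin 2) ℂ)).support ↔ s • d ∈ F.support := by
  rw [mem_support_iff, mem_support_iff, coeff_latticePart hs]

/-! ## Residues off and on the lattice -/

/-- **Two-base residue, off the lattice.**  For a positive scale vector `s`, `G(0) ≠ 0` and a
strictly positive weight `w`: a support point `e` of `F * G(x^{s₀}, y^{s₁})` that is strictly
`w`-lighter than every other nonzero support point and does not lie on the lattice `s • ℕ²` is a
support point of the fine factor `F`. -/
theorem residueOff {s : Fin 2 → ℕ} (hs : ∀ j, 1 ≤ s j) (F G : MvPolynomial (Fin 2) ℂ)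
    (hG0 : coeff 0 G ≠ 0) (w : Fin 2 → ℤ) (hw0 : 0 < w 0) (hw1 : 0 < w 1) (e : Fin 2 →₀ ℕ)
    (heP : e ∈ (F * bind₁ (fun j => (X j : MvPolynomial (Fin 2) ℂ) ^ s j) G).support)
    (hmin : ∀ e' ∈ (F * bind₁ (fun j => (X j : MvPolynomial (Fin 2) ℂ) ^ s j) G).support,
      e' ≠ 0 → e' ≠ e → w 0 * (e 0 : ℤ) + w 1 * (e 1 : ℤ) < w 0 * (e' 0 : ℤ) + w 1 * (e' 1 : ℤ))
    (hndvd : ¬ (s 0 ∣ e 0 ∧ s 1 ∣ e 1)) : e ∈ F.support := by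
  classical
  -- Step 1: `e = a + s • b` with `F_a ≠ 0`, `G_b ≠ 0`.
  have heP' := mem_support_iff.mp heP
  rw [coeff_mul] at heP'
  obtain ⟨x, hx, hxne⟩ := Finset.exists_ne_zero_of_sum_ne_zero heP'
  have hxa : coeff x.1 F ≠ 0 := left_ne_zero_of_mul hxne
  obtain ⟨b, -, hxb⟩ := exists_of_coeff_dil_ne_zero s G (right_ne_zero_of_mul hxne)
  rw [Finset.HasAntidiagonal.mem_antidiagonal] at hx
  -- The residue class of `e` inside `supp F`.
  set T : Finset (Fin 2 →₀ ℕ) :=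
    F.support.filter (fun d => d 0 % s 0 = e 0 % s 0 ∧ d 1 % s 1 = e 1 % s 1) with hT
  have hmemT : ∀ d, d ∈ T ↔ coeff d F ≠ 0 ∧ d 0 % s 0 = e 0 % s 0 ∧ d 1 % s 1 = e 1 % s 1 := by
    intro d
    rw [hT, Finset.mem_filter, mem_support_iff]
  have haT : x.1 ∈ T := by
    rw [hmemT]
    refine ⟨hxa, ?_, ?_⟩
    · rw [← hx, hxb, mod_add_smul_apply]
    · rw [← hx, hxb, mod_add_smul_apply]
  -- Step 2: a `w`-lightest element `d₀` of the class.
  obtain ⟨d₀, hd₀T, hd₀min⟩ :=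
    T.exists_min_image (fun d => w 0 * (d 0 : ℤ) + w 1 * (d 1 : ℤ)) ⟨x.1, haT⟩
  obtain ⟨hd₀F, hd₀0, hd₀1⟩ := (hmemT d₀).mp hd₀T
  -- Step 3: `coeff d₀ (F * G(x^{s₀}, y^{s₁})) = F_{d₀} * G_0`.
  have hcoeff : coeff d₀ (F * bind₁ (fun j => (X j : MvPolynomial (Fin 2) ℂ) ^ s j) G) =
      coeff d₀ F * coeff 0 G := by
    rw [coeff_mul, Finset.sum_eq_single (d₀, (0 : Fin 2 →₀ ℕ))]
    · rw [coeff_zero_dil hs]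
    · intro y hy hyne
      by_contra hyz
      have hya : coeff y.1 F ≠ 0 := left_ne_zero_of_mul hyz
      obtain ⟨b', -, hyb⟩ := exists_of_coeff_dil_ne_zero s G (right_ne_zero_of_mul hyz)
      rw [Finset.HasAntidiagonal.mem_antidiagonal] at hy
      have hb'ne : b' ≠ 0 := by
        rintro rfl
        apply hyne
        have hy2 : y.2 = 0 := by rw [hyb, smul_zero]
        have hy1 : y.1 = d₀ := by rw [← hy, hy2, add_zero]
        exact Prod.ext hy1 hy2
      have hy1T : y.1 ∈ T := by
        rw [hmemT]
        refine ⟨hya, ?_, ?_⟩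
        · rw [← hd₀0, ← hy, hyb, mod_add_smul_apply]
        · rw [← hd₀1, ← hy, hyb, mod_add_smul_apply]
      have h1 : w 0 * (d₀ 0 : ℤ) + w 1 * (d₀ 1 : ℤ) ≤ w 0 * (y.1 0 : ℤ) + w 1 * (y.1 1 : ℤ) :=
        hd₀min y.1 hy1T
      have h2 : w 0 * (d₀ 0 : ℤ) + w 1 * (d₀ 1 : ℤ) = (w 0 * (y.1 0 : ℤ) + w 1 * (y.1 1 : ℤ)) +
          (w 0 * (s 0 : ℤ) * (b' 0 : ℤ) + w 1 * (s 1 : ℤ) * (b' 1 : ℤ)) := by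
        rw [← hy, hyb]
        exact wt_add_smul w s y.1 b'
      have h3 : 0 < w 0 * (s 0 : ℤ) * (b' 0 : ℤ) + w 1 * (s 1 : ℤ) * (b' 1 : ℤ) :=
        DepthOne.wt_pos (fun j => w j * (s j : ℤ)) (twist_pos hs 0 hw0) (twist_pos hs 1 hw1)
          b' hb'ne
      linarith
    · intro h
      exact absurd (Finset.HasAntidiagonal.mem_antidiagonal.mpr (add_zero d₀)) h
  -- Step 4: `d₀` is a nonzero support point of the product.
  have hd₀P : d₀ ∈ (F * bind₁ (fun j => (X j : MvPolynomial (Fin 2) ℂ) ^ s j) G).support := by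
    rw [mem_support_iff, hcoeff]
    exact mul_ne_zero hd₀F hG0
  have hd₀ne : d₀ ≠ 0 := by
    rintro rfl
    apply hndvd
    simp only [Finsupp.coe_zero, Pi.zero_apply, Nat.zero_mod] at hd₀0 hd₀1
    exact ⟨Nat.dvd_of_mod_eq_zero hd₀0.symm, Nat.dvd_of_mod_eq_zero hd₀1.symm⟩
  -- Step 5: strict minimality of `e` forces `e = d₀`.
  by_cases hde : d₀ = e
  · rw [← hde]
    exact mem_support_iff.mpr hd₀F
  · exfalso
    have hlt := hmin d₀ hd₀P hd₀ne hde
    have h1 : w 0 * (d₀ 0 : ℤ) + w 1 * (d₀ 1 : ℤ) ≤ w 0 * (x.1 0 : ℤ) + w 1 * (x.1 1 : ℤ) :=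
      hd₀min x.1 haT
    have h2 : w 0 * (e 0 : ℤ) + w 1 * (e 1 : ℤ) = (w 0 * (x.1 0 : ℤ) + w 1 * (x.1 1 : ℤ)) +
        (w 0 * (s 0 : ℤ) * (b 0 : ℤ) + w 1 * (s 1 : ℤ) * (b 1 : ℤ)) := by
      rw [← hx, hxb]
      exact wt_add_smul w s x.1 b
    have h3 : 0 ≤ w 0 * (s 0 : ℤ) * (b 0 : ℤ) + w 1 * (s 1 : ℤ) * (b 1 : ℤ) :=
      DepthOne.wt_nonneg (fun j => w j * (s j : ℤ)) (twist_pos hs 0 hw0) (twist_pos hs 1 hw1) b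
    linarith

/-- **Mahler coefficient identity** (two-base residue on the lattice).  If `F₀` is the lattice
part of `F`, i.e. `coeff d F₀ = coeff (s • d) F` for all `d`, then
`coeff (s • q) (F * G(x^{s₀}, y^{s₁})) = coeff q (F₀ * G)` for every `q` (positive scale vector). -/
theorem coeff_smul_mul_dil {s : Fin 2 → ℕ} (hs : ∀ j, 1 ≤ s j) (F F₀ G : MvPolynomial (Fin 2) ℂ)
    (hF₀ : ∀ d : Fin 2 →₀ ℕ, coeff d F₀ = coeff (s • d) F) (q : Fin 2 →₀ ℕ) :
    coeff (s • q) (F * bind₁ (fun j => (X j : MvPolynomial (Fin 2) ℂ) ^ s j) G) =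
      coeff q (F₀ * G) := by
  conv_lhs => rw [G.as_sum]
  conv_rhs => rw [G.as_sum]
  rw [map_sum, Finset.mul_sum, Finset.mul_sum, coeff_sum, coeff_sum]
  refine Finset.sum_congr rfl fun b _ => ?_
  rw [dil_monomial, coeff_mul_monomial', coeff_mul_monomial']
  by_cases hb : b ≤ q
  · rw [if_pos ((pointwise_smul_le_iff hs b q).mpr hb), if_pos hb, smul_tsub_smul, hF₀]
  · rw [if_neg (fun h => hb ((pointwise_smul_le_iff hs b q).mp h)), if_neg hb]

/-! ## One residue step -/

/-- THE RESIDUE STEP (registered sub-goal `stub_twoBaseRadixResidueStep` of the stub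
`stub_engineTwoBaseRadix`).  For a positive scale vector `s` and `G(0) = 1`: a south-west vertex of
`supp(F · G(x^{s₀}, y^{s₁})) ∖ 0` is a monomial of `F` (off the lattice `s • ℕ²`) or `s •` a
south-west vertex of `supp(F₀ · G) ∖ 0`, `F₀ = ∑_d F_{s • d} x^d` the lattice part of `F` (on the
lattice; for the twisted weight `(w₀ s₀, w₁ s₁)`). -/
theorem stub_twoBaseRadixResidueStep : ∀ (s : Fin 2 → ℕ) (F G : MvPolynomial (Fin 2) ℂ), (∀ j, 1 ≤ s j) →
    MvPolynomial.coeff 0 G = 1 →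
    {e : Fin 2 →₀ ℕ | ∃ w : Fin 2 → ℤ, 0 < w 0 ∧ 0 < w 1 ∧ e ≠ 0 ∧
      e ∈ (F * MvPolynomial.bind₁ (fun j : Fin 2 => (MvPolynomial.X j : MvPolynomial (Fin 2) ℂ) ^ s j) G).support ∧
      ∀ e' ∈ (F * MvPolynomial.bind₁ (fun j : Fin 2 => (MvPolynomial.X j : MvPolynomial (Fin 2) ℂ) ^ s j) G).support,
        e' ≠ 0 → e' ≠ e → w 0 * (e 0 : ℤ) + w 1 * (e 1 : ℤ) < w 0 * (e' 0 : ℤ) + w 1 * (e' 1 : ℤ)} ⊆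
    (F.support : Set (Fin 2 →₀ ℕ)) ∪ (fun e : Fin 2 →₀ ℕ => s • e) ''
      {e : Fin 2 →₀ ℕ | ∃ w : Fin 2 → ℤ, 0 < w 0 ∧ 0 < w 1 ∧ e ≠ 0 ∧
        e ∈ ((∑ d ∈ F.support.image (fun e : Fin 2 →₀ ℕ => Finsupp.equivFunOnFinite.symm (⇑e / s)),
          MvPolynomial.monomial d (MvPolynomial.coeff (s • d) F)) * G).support ∧
        ∀ e' ∈ ((∑ d ∈ F.support.image (fun e : Fin 2 →₀ ℕ => Finsupp.equivFunOnFinite.symm (⇑e / s)),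
          MvPolynomial.monomial d (MvPolynomial.coeff (s • d) F)) * G).support, e' ≠ 0 → e' ≠ e →
          w 0 * (e 0 : ℤ) + w 1 * (e 1 : ℤ) < w 0 * (e' 0 : ℤ) + w 1 * (e' 1 : ℤ)} := by
  intro s F G hs hG
  rintro e ⟨w, hw0, hw1, he0, heP, hmin⟩
  set F₀ : MvPolynomial (Fin 2) ℂ := ∑ d ∈ F.support.image
    (fun e : Fin 2 →₀ ℕ => Finsupp.equivFunOnFinite.symm (⇑e / s)), monomial d (coeff (s • d) F) with hF₀
  by_cases hdvd : s 0 ∣ e 0 ∧ s 1 ∣ e 1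
  · right
    have hcoef : ∀ q : Fin 2 →₀ ℕ,
        coeff (s • q) (F * bind₁ (fun j => (X j : MvPolynomial (Fin 2) ℂ) ^ s j) G) =
          coeff q (F₀ * G) :=
      coeff_smul_mul_dil hs F F₀ G (coeff_latticePart hs F)
    have hee : s • Finsupp.equivFunOnFinite.symm (⇑e / s) = e := smul_ediv_of_dvd hdvd
    refine ⟨Finsupp.equivFunOnFinite.symm (⇑e / s),
      ⟨fun j => w j * (s j : ℤ), twist_pos hs 0 hw0, twist_pos hs 1 hw1, ?_, ?_, ?_⟩, hee⟩
    · intro h0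
      apply he0
      rw [← hee, h0, smul_zero]
    · rw [mem_support_iff, ← hcoef, hee]
      exact mem_support_iff.1 heP
    · intro q hq hq0 hqe
      have hsq : s • q ∈ (F * bind₁ (fun j => (X j : MvPolynomial (Fin 2) ℂ) ^ s j) G).support := by
        rw [mem_support_iff, hcoef]
        exact mem_support_iff.1 hq
      have hsqe : s • q ≠ e := by
        intro h
        apply hqe
        rw [← ediv_smul hs q, h]
      have hlt := hmin (s • q) hsq (smul_ne_zero_of_ne_zero hs hq0) hsqe
      rw [← hee, wt_smul, wt_smul] at hlt
      exact hlt
  · left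
    have hG0 : coeff 0 G ≠ 0 := by
      rw [hG]
      exact one_ne_zero
    exact Finset.mem_coe.2 (residueOff hs F G hG0 w hw0 hw1 e heP hmin hdvd)

end Summit.ValiantsHypothesis.ValiantsHypothesis.Theorems.TwoProducts.TwoBaseRadixResidue
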